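import Summits.QuantumFields.YangMills.Theorems.BalabanLadderIRColdPuritySlabChain
import Summits.QuantumFields.YangMills.Theorems.BalabanLadderIRColdPurityBridge
import Literature.MathematicalPhysics.QuantumFieldTheory.WilsonTorusTransferGapExplicit
import HarnessLib

/-!
# Route `BalabanLadder`, crux `IR` (stmt-QuantumFields-19354): SLAB DECOUPLING, part 2 — a KERNEL purity bound for the
# cold period-doubling defect at the decl's own boxes: `coldDefect ρ β L ≤ 1 − e^{−12 n β L³} ≤ 12 n β L³`

Instrument seat `ym-ir-eng-4` (generation g5), cell `pub/ym-ir` (`--supports stmt-QuantumFields-19354`, helper; no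
registered stub is claimed).  Part 1 (`BalabanLadderIRColdPuritySlabChain`) is the model-free cut estimate for cyclic
kernel chains; this part applies it to Wilson's theory.

**What is proved (all `theorem`s, hypothesis-free, group-blind).**  For every compact second-countable group `G`, every
continuous unitary representation `ρ` of dimension `n`, every `β ≥ 0`:
* `wilsonSliceKernel_two_sided`: the Wilson time-slice kernel satisfies the two-sided rank-one bound
  `e^{−6nβN³}·a(U)a(U') ≤ K_β(U,U') ≤ a(U)a(U')`, `a = e^{−βS₃/2}` (the Gauss-law factor `∫ e^{−βS_tm} dg` lies in
  `[e^{−6nβN³}, 1]`: the tree's `WilsonTransferGapExplicit.exp_neg_le_integral_exp_neg_sliceTemporalAction_le`);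
* `cyclicPartition_sq_le_exp_mul_cyclicPartition(_two_mul)`, `wilsonFinTorusPartition_sq_le_exp_mul_two_mul`,
  `exp_neg_le_wilsonFinTorusPartition_ratio`: **`Z_β(L³×t)² ≤ e^{12nβL³}·Z_β(L³×2t)`** for all `L, t ≥ 1`, i.e. the
  period-doubling ratio `Z(L³×2t)/Z(L³×t)²` is at least `e^{−12nβL³}` — by part 1 (cut one bond of the `t`-cycle from
  above, two antipodal bonds of the `2t`-cycle from below; NO expansion, uniform in `t`);
* `coldDefect_le_one_sub_exp`, `coldDefect_le_mul`: for `L ≥ 4`, **`coldDefect ρ β L ≤ 1 − e^{−12nβL³} ≤ 12·n·β·L³`**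
  (the tree functional `ColdPurityBridge.coldDefect` = the seed functional of `ColdExitAt` / `PinnedExitAt` / `PinnedExitsCofinalAt`);
* `coldDefect_le_of_mul_le`, and for a `LatticeRep` (which supplies second countability): `coldDefect_latticeRep_le_mul`,
  **`coldDefect_eight_le_one_div_24`** (`147456·n·β ≤ 1 ⇒ δᶜ_β(8) ≤ 1/24`) and `coldDefect_eight_le_inv_two_pow_six`
  (`393216·n·β ≤ 1 ⇒ δᶜ_β(8) ≤ 2⁻⁶`).

**Reading (PORTRAIT §17 of the seat's desk `pub/ym-ir/ym-ir-eng-4/PORTRAIT.md`).**  For `SU(2)`, fundamental (`n = 2`,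
Wilson `β_W = 2β`): `δᶜ_β(8) ≤ 12288·β`, so THE NUMBER's inequality `δᶜ ≤ 1/24` holds in the kernel for
`0 ≤ β_W ≤ 1/147456 ≈ 6.8·10⁻⁶` at the decl's MINIMUM box `L = 8` (and `δᶜ_β(L) ≤ 1/24` for `β_W ≤ 1/(288·L³)` at every
`L ≥ 4`).  Before this file the tree's only purity theorem was `ColdPurityBridge.coldDefect_le_of_strongCoupling`
(cluster expansion): `β_W ≲ 2.6·10⁻⁷` AND `L = 8k ≥ 216` — silent at every `L < 216`.  The two are complementary
(`L⁻³` window without decay in `t` here; `t`-decay but an `L ≥ 216` floor there).  The certified-CONDITIONAL corner of the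
cell (E4-P7 / E2-Q2: `β_W ≤ 0.022–0.036` at `L = 8`, conditional on KP86 + a paper lemma) is ×3000–5000 wider and NOT a
Lean theorem; this file does not change it.

HONEST FRAMING.  Small-β bookkeeping in the kernel, group-blind (it holds verbatim for `U(1)`), width 0 toward `PX` /
`PXcof` (β → ∞ objects); `BalabanLadder.IR` / `.IRcof` are NOT closed (0/1); the Yang–Mills mass gap (Clay) is NOT
proved by any of this; R4 closes only the conditional finite-𝕋⁴ rung `BalabanLadder.UV`.
-/

noncomputable section

open MeasureTheory Filter Function
open Literature.MathematicalPhysics.QuantumFieldTheory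

namespace Summit.QuantumFields.YangMills.Cruxes.IR.ColdPuritySlabDecoupling

open Summit.QuantumFields.YangMills.Cruxes.IR.ColdPurityBridge (coldDefect)

/-! ## §1 The Wilson slice kernel obeys a two-sided rank-one bound; period doubling of `Z(L³ × t)` -/

section Wilson

variable {G : Type} [Group G] [TopologicalSpace G] [IsTopologicalGroup G] [CompactSpace G]
  [MeasurableSpace G] [BorelSpace G] [SecondCountableTopology G] {n : ℕ} (ρ : G →* Matrix (Fin n) (Fin n) ℂ)
  {N : ℕ} [NeZero N]

/-! ### The two-sided rank-one bound on the Wilson slice kernel -/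

/-- **Two-sided rank-one bound on the Wilson slice kernel**: with `a(U) = e^{-β S₃(U)/2}`,
`e^{-6nβN³} · a(U) a(U') ≤ K_β(U,U') ≤ a(U) a(U')` (`β ≥ 0`, unitary continuous `ρ`). [folklore] -/
theorem wilsonSliceKernel_two_sided (hρ : Continuous ρ) (hρu : ∀ g, ρ g ∈ Matrix.unitaryGroup (Fin n) ℂ)
    {β : ℝ} (hβ : 0 ≤ β) (U U' : GaugeConfig 3 N G) :
    Real.exp (-(β * (6 * n * (N : ℝ) ^ 3))) *
          (Real.exp (-(β * wilsonAction ρ U / 2)) * Real.exp (-(β * wilsonAction ρ U' / 2))) ≤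
        wilsonSliceKernel ρ β U U' ∧
      wilsonSliceKernel ρ β U U' ≤
        Real.exp (-(β * wilsonAction ρ U / 2)) * Real.exp (-(β * wilsonAction ρ U' / 2)) := by
  obtain ⟨hlo, hhi⟩ := WilsonTransferGapExplicit.exp_neg_le_integral_exp_neg_sliceTemporalAction_le ρ hρ hρu hβ U U'
  have ha : 0 ≤ Real.exp (-(β * wilsonAction ρ U / 2)) := (Real.exp_pos _).le
  have ha' : 0 ≤ Real.exp (-(β * wilsonAction ρ U' / 2)) := (Real.exp_pos _).le
  unfold wilsonSliceKernel
  constructor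
  · calc Real.exp (-(β * (6 * n * (N : ℝ) ^ 3))) *
          (Real.exp (-(β * wilsonAction ρ U / 2)) * Real.exp (-(β * wilsonAction ρ U' / 2)))
        = Real.exp (-(β * wilsonAction ρ U / 2)) * Real.exp (-(β * (6 * n * (N : ℝ) ^ 3))) *
            Real.exp (-(β * wilsonAction ρ U' / 2)) := by ring
      _ ≤ _ := mul_le_mul_of_nonneg_right (mul_le_mul_of_nonneg_left hlo ha) ha'
  · calc _ ≤ Real.exp (-(β * wilsonAction ρ U / 2)) * 1 * Real.exp (-(β * wilsonAction ρ U' / 2)) :=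
          mul_le_mul_of_nonneg_right (mul_le_mul_of_nonneg_left hhi ha) ha'
      _ = _ := by rw [mul_one]

/-! ### Period doubling -/

/-- **`Z_β(N³ × t)² ≤ e^{12nβN³} · Z_β(N³ × m)` for `m = t + t`** (`β ≥ 0`, continuous unitary `ρ`, `t ≥ 1`):
slab decoupling of the cyclic chain of Wilson slice kernels (`sq_integral_cyclicProd_le_exp_mul_integral_cyclicProd`
with `a = e^{-βS₃/2}`, `c = 6nβN³`).  Expansion-free and uniform in `t`. [folklore] -/
theorem cyclicPartition_sq_le_exp_mul_cyclicPartition (hρ : Continuous ρ)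
    (hρu : ∀ g, ρ g ∈ Matrix.unitaryGroup (Fin n) ℂ) {β : ℝ} (hβ : 0 ≤ β) (t : ℕ) [NeZero t] {m : ℕ} [NeZero m]
    (hm : m = t + t) :
    cyclicPartition ρ β N t ^ 2 ≤ Real.exp (2 * (β * (6 * n * (N : ℝ) ^ 3))) * cyclicPartition ρ β N m := by
  obtain ⟨s, rfl⟩ : ∃ s, t = s + 1 := ⟨t - 1, by have := NeZero.ne t; omega⟩
  obtain ⟨k, rfl⟩ : ∃ k, m = k + 1 := ⟨m - 1, by have := NeZero.ne m; omega⟩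
  have hK : Measurable (uncurry (wilsonSliceKernel ρ β : GaugeConfig 3 N G → GaugeConfig 3 N G → ℝ)) :=
    (stronglyMeasurable_uncurry_wilsonSliceKernel ρ hρ β).measurable
  have ha : Measurable fun U : GaugeConfig 3 N G => Real.exp (-(β * wilsonAction ρ U / 2)) :=
    (((WilsonRP.measurable_wilsonAction (d := 3) (L := N) ρ hρ).const_mul β).div_const 2).neg.exp
  have ha0 : ∀ U : GaugeConfig 3 N G, 0 ≤ Real.exp (-(β * wilsonAction ρ U / 2)) := fun U => (Real.exp_pos _).le
  have ha1 : ∀ U : GaugeConfig 3 N G, Real.exp (-(β * wilsonAction ρ U / 2)) ≤ 1 :=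
    fun U => exp_neg_half_wilsonAction_le_one ρ hρu hβ U
  have h2 := fun U U' : GaugeConfig 3 N G => wilsonSliceKernel_two_sided ρ hρ hρu hβ U U'
  have h := sq_integral_cyclicProd_le_exp_mul_integral_cyclicProd
    (μ := Measure.pi fun _ : Edge 3 N => haarProbability G) hK ha ha0 ha1 (fun U U' => (h2 U U').1)
    (fun U U' => (h2 U U').2) (t := s + 1) (m := k + 1) hm
  unfold cyclicPartition
  exact h

/-- **`Z_β(N³ × t)² ≤ e^{12nβN³} · Z_β(N³ × 2t)`** (`β ≥ 0`, continuous unitary `ρ`, `t ≥ 1`). [folklore] -/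
theorem cyclicPartition_sq_le_exp_mul_cyclicPartition_two_mul (hρ : Continuous ρ)
    (hρu : ∀ g, ρ g ∈ Matrix.unitaryGroup (Fin n) ℂ) {β : ℝ} (hβ : 0 ≤ β) (t : ℕ) [NeZero t] [NeZero (2 * t)] :
    cyclicPartition ρ β N t ^ 2 ≤ Real.exp (12 * n * β * (N : ℝ) ^ 3) * cyclicPartition ρ β N (2 * t) := by
  have h := cyclicPartition_sq_le_exp_mul_cyclicPartition (N := N) ρ hρ hρu hβ t (m := 2 * t) (two_mul t)
  have he : (2 * (β * (6 * n * (N : ℝ) ^ 3))) = 12 * n * β * (N : ℝ) ^ 3 := by ring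
  rwa [he] at h

/-- **The `Fin`-torus form: `Z_β(L,L,L,t)² ≤ e^{12nβL³} · Z_β(L,L,L,2t)`** for `L, t ≥ 1`, `β ≥ 0`, continuous
unitary `ρ` (via `wilsonFinTorusPartition_eq_cyclicPartition`).  Equivalently: the period-doubling ratio
`Z(L³×2t)/Z(L³×t)² ≥ e^{-12nβL³}`. [folklore] -/
theorem wilsonFinTorusPartition_sq_le_exp_mul_two_mul (hρ : Continuous ρ)
    (hρu : ∀ g, ρ g ∈ Matrix.unitaryGroup (Fin n) ℂ) {β : ℝ} (hβ : 0 ≤ β) (L t : ℕ) [NeZero L] [NeZero t] :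
    wilsonFinTorusPartition ρ β L L L t ^ 2 ≤
      Real.exp (12 * n * β * (L : ℝ) ^ 3) * wilsonFinTorusPartition ρ β L L L (2 * t) := by
  haveI : NeZero (2 * t) := ⟨by have := NeZero.ne t; omega⟩
  rw [wilsonFinTorusPartition_eq_cyclicPartition hρ hρu β L t, wilsonFinTorusPartition_eq_cyclicPartition hρ hρu β L (2 * t)]
  exact cyclicPartition_sq_le_exp_mul_cyclicPartition_two_mul (N := L) ρ hρ hρu hβ t

/-- **Lower bound on the period-doubling ratio**: `e^{-12nβL³} ≤ Z_β(L,L,L,2t) / Z_β(L,L,L,t)²`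
(`L, t ≥ 1`, `β ≥ 0`, continuous unitary `ρ`). [folklore] -/
theorem exp_neg_le_wilsonFinTorusPartition_ratio (hρ : Continuous ρ)
    (hρu : ∀ g, ρ g ∈ Matrix.unitaryGroup (Fin n) ℂ) {β : ℝ} (hβ : 0 ≤ β) (L t : ℕ) [NeZero L] [NeZero t] :
    Real.exp (-(12 * n * β * (L : ℝ) ^ 3)) ≤
      wilsonFinTorusPartition ρ β L L L (2 * t) / wilsonFinTorusPartition ρ β L L L t ^ 2 := by
  have hZ : 0 < wilsonFinTorusPartition ρ β L L L t := wilsonFinTorusPartition_pos hρ β L L L t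
  have h := wilsonFinTorusPartition_sq_le_exp_mul_two_mul ρ hρ hρu hβ L t
  rw [le_div_iff₀ (pow_pos hZ 2), Real.exp_neg, inv_mul_le_iff₀ (Real.exp_pos _)]
  exact h


end Wilson

/-! ## §2 The purity bound at the decl's own boxes -/

section Purity

variable {G : Type} [Group G] [TopologicalSpace G] [IsTopologicalGroup G] [CompactSpace G]
  [MeasurableSpace G] [BorelSpace G]

/-- **`coldDefect ρ β L ≤ 1 − e^{−12nβL³}`** for `L ≥ 4`, `β ≥ 0`, continuous unitary `ρ` of dimension `n` on a
second-countable compact `G`: the purity `Z(L³×2t)/Z(L³×t)²`, `t = ⌊L/4⌋ ≥ 1`, is at least `e^{−12nβL³}`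
(`exp_neg_le_wilsonFinTorusPartition_ratio`).  Hypothesis-free, group-blind, expansion-free. -/
theorem coldDefect_le_one_sub_exp [SecondCountableTopology G] {n : ℕ} {ρ : G →* Matrix (Fin n) (Fin n) ℂ}
    (hρ : Continuous ρ) (hρu : ∀ g, ρ g ∈ Matrix.unitaryGroup (Fin n) ℂ) {β : ℝ} (hβ : 0 ≤ β) {L : ℕ} (hL : 4 ≤ L) :
    coldDefect ρ β L ≤ 1 - Real.exp (-(12 * n * β * (L : ℝ) ^ 3)) := by
  haveI : NeZero L := ⟨by omega⟩
  haveI : NeZero (L / 4) := ⟨by omega⟩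
  have h := exp_neg_le_wilsonFinTorusPartition_ratio ρ hρ hρu hβ L (L / 4)
  unfold coldDefect
  linarith

/-- **`coldDefect ρ β L ≤ 12·n·β·L³`** for `L ≥ 4`, `β ≥ 0` (from `1 − e^{−x} ≤ x`). -/
theorem coldDefect_le_mul [SecondCountableTopology G] {n : ℕ} {ρ : G →* Matrix (Fin n) (Fin n) ℂ}
    (hρ : Continuous ρ) (hρu : ∀ g, ρ g ∈ Matrix.unitaryGroup (Fin n) ℂ) {β : ℝ} (hβ : 0 ≤ β) {L : ℕ} (hL : 4 ≤ L) :
    coldDefect ρ β L ≤ 12 * n * β * (L : ℝ) ^ 3 := by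
  have h := coldDefect_le_one_sub_exp hρ hρu hβ hL
  have he := Real.add_one_le_exp (-(12 * n * β * (L : ℝ) ^ 3))
  linarith

/-- **THE NUMBER's inequality at small coupling, any threshold**: `12·n·β·L³ ≤ θ ⇒ coldDefect ρ β L ≤ θ` (`L ≥ 4`,
`β ≥ 0`). -/
theorem coldDefect_le_of_mul_le [SecondCountableTopology G] {n : ℕ} {ρ : G →* Matrix (Fin n) (Fin n) ℂ}
    (hρ : Continuous ρ) (hρu : ∀ g, ρ g ∈ Matrix.unitaryGroup (Fin n) ℂ) {β : ℝ} (hβ : 0 ≤ β) {L : ℕ} (hL : 4 ≤ L)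
    {θ : ℝ} (hθ : 12 * n * β * (L : ℝ) ^ 3 ≤ θ) : coldDefect ρ β L ≤ θ :=
  (coldDefect_le_mul hρ hρu hβ hL).trans hθ

/-- **Lattice-representation form** (the binder of `ColdExitAt` / `PinnedExitAt`): for every `r : LatticeRep G`
(faithful continuous unitary, hence `G` second countable), `β ≥ 0`, `L ≥ 4`: `coldDefect r.ρ β L ≤ 12·r.N·β·L³`. -/
theorem coldDefect_latticeRep_le_mul (r : LatticeRep G) {β : ℝ} (hβ : 0 ≤ β) {L : ℕ} (hL : 4 ≤ L) :
    coldDefect r.ρ β L ≤ 12 * r.N * β * (L : ℝ) ^ 3 := by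
  haveI : SecondCountableTopology G :=
    (r.continuous.isClosedEmbedding r.injective).isEmbedding.secondCountableTopology
  exact coldDefect_le_mul r.continuous r.mem_unitary hβ hL

/-- **THE NUMBER at the decl's minimum box, in the kernel: `147456·N·β ≤ 1 ⇒ δᶜ_β(8) ≤ 1/24`** for every
`r : LatticeRep G` of dimension `N`, `β ≥ 0` (`12·N·β·8³ = 6144·N·β`).  For `SU(2)`, fundamental (`N = 2`, `β_W = 2β`):
`β_W ≤ 1/147456 ≈ 6.78·10⁻⁶`. -/
theorem coldDefect_eight_le_one_div_24 (r : LatticeRep G) {β : ℝ} (hβ : 0 ≤ β) (h : 147456 * r.N * β ≤ 1) :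
    coldDefect r.ρ β 8 ≤ 1 / 24 := by
  have h8 := coldDefect_latticeRep_le_mul r hβ (L := 8) (by norm_num)
  have : (12 : ℝ) * r.N * β * (8 : ℕ) ^ 3 = 6144 * r.N * β := by push_cast; ring
  rw [this] at h8
  linarith

/-- **The `2⁻⁶` variant: `393216·N·β ≤ 1 ⇒ δᶜ_β(8) ≤ 2⁻⁶`** (`r : LatticeRep G` of dimension `N`, `β ≥ 0`).  For `SU(2)`,
fundamental: `β_W ≤ 1/393216 ≈ 2.5·10⁻⁶`. -/
theorem coldDefect_eight_le_inv_two_pow_six (r : LatticeRep G) {β : ℝ} (hβ : 0 ≤ β) (h : 393216 * r.N * β ≤ 1) :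
    coldDefect r.ρ β 8 ≤ 1 / 2 ^ 6 := by
  have h8 := coldDefect_latticeRep_le_mul r hβ (L := 8) (by norm_num)
  have : (12 : ℝ) * r.N * β * (8 : ℕ) ^ 3 = 6144 * r.N * β := by push_cast; ring
  rw [this] at h8
  norm_num
  linarith

end Purity

end Summit.QuantumFields.YangMills.Cruxes.IR.ColdPuritySlabDecoupling

end
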